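import Summits.QuantumFields.BalabanUV.T4Continuum.Support.VariationalCovariantFederbush
import Mathlib.Analysis.InnerProductSpace.Adjoint

/-!
# T⁴ programme, spine node NE2 (U1a), lane P2 — SUPPLIER ITEM (O8) «V-COL-FED»: THE COVARIANT FEDERBUSH INEQUALITY, ADDITIVE
# FORM, for 0-FORMS WITH VALUES IN A NORMED ℂ-SPACE `E` transported by continuous linear maps of operator norm `≤ 1`
# (the colour ∕ matrix re-run of leaf FED⁺ `VariationalCovariantFederbush` p210720; one block step, every torus)

NE2 formalisation swarm `b2b-balaban-t4-ne2-formalise-*`, leaf prover 02 (gen 4); P2 skeleton `t4/skeletons/NE2-t4-ne2-p2.md` v0.10 §2.E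
row V-COL («the COLOUR (adjoint ∕ matrix) re-run of §2.C's FED⁺ ∕ UB⁺ ∕ ONE⁺ ∕ P⁺ ∕ REG⁺ for M_o(ℂ)-valued 0-FORMS under `siteMul` transport by
unitary matrices: same competitors, ‖·‖ → Frobenius, defects in operator norm») — THIS FILE IS ITS FED⁺ MEMBER, on the road's carriers
(`B5Prop11Plancherel.Tor ∕ fine ∕ unitVec`, `B5Block118.bpt ∕ tstep`), the ℝ-side of the scalar leaf (`sum_sq_main_le`, `sum_sq_defect_le`,
`sum_sq_add_le`, `invLd_mul_sqrt`, `sum_fin_sq_add_le`) imported BY NAME.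

THE POINT.  The scalar leaf's proof uses NO commutativity: its two `ring` steps are the ORDER-PRESERVING identities
`R̄·T′(b+Le)·f′(b+Le) − T′(b)·f′(b) = Mis·f′(b+Le) + T′(b)·(Π_L·f′(b+Le) − f′(b))`, `Π_{t+1} = Π_t ∘ R′(b + t e)`, and every estimate is
`‖A v‖ ≤ ‖A‖·‖v‖` with `‖A‖ ≤ 1`.  So the SAME statement, with the SAME constants, holds for a fine field `f′ : Tor (fine L N) → E` valued in
ANY normed ℂ-space `E` and transporters `R̄, R′, T′` in the normed ring `E →L[ℂ] E` of operator norm `≤ 1` — ONE lemma for the scalar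
(`E = ℂ`), fundamental (`E = ℂ^o`) and `siteMul`-on-`M_o(ℂ)` (Frobenius = `o` copies of `ℂ^o`) readings of §2.E:
 * §1 carriers `cDv R f y μ = R(y,μ)(f(y+e_μ)) − f(y)`, `dirUv` (its sum of squares), `Qcv T′ f′ y = (L^d)⁻¹ • Σ_j T′(bpt y j)(f′(bpt y j))`,
   `piTv` (straight transporter, a product in `E →L[ℂ] E`), `misv = R̄(y,μ)∘T′(bpt (y+e_μ) j) − T′(bpt y j)∘Π_L(bpt y j, μ)`;
 * §2 `piTv_telescope`, `norm_piTv_le_one`; §3 the EXACT decomposition `cDv_Qcv_eq`, the pointwise bound `norm_cDv_Qcv_le`;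
 * §4 **`dirUv_Qcv_le`**: `Σ_y ‖(D_{R̄} Q_{T′} f′)(y,μ)‖² ≤ (√(L²·X_μ∕L^d) + m·√(Y∕L^d))²`, `X_μ = Σ‖D_{R′}f′(·,μ)‖²`, `Y = Σ‖f′‖²`, `sup‖Mis‖_op ≤ m`
   (main term constant EXACTLY 1; the background ONLY through `m`, linearly inside the square); **`sum_dirUv_Qcv_le`** (over μ, factor `√d`);
 * §5 READINGS: at `E = ℂ` the carriers ARE the scalar leaf's (`cDv_phase`, `dirUv_phase`, `Qcv_phase`, `piTv_phase`, `norm_misv_phase`);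
   for UNITARY transporters on a Hilbert space the contraction binders are discharged (`dirUv_Qcv_le_of_unitary`); the MATRIX reading
   `E = EuclideanSpace ℂ o`, unitary colour matrices through Mathlib's ⋆-algebra equivalence `Matrix.toEuclideanCLM`
   (`toEuclideanCLM_mem_unitary`, **`dirUv_Qcv_le_matrix`**: no binder left but the mismatch bound `m` in the L²-operator norm).
WHAT IS NOT HERE (stated, not hidden): V-COL's other members (UB⁺ ∕ ONE⁺ ∕ P⁺ ∕ REG⁺ in colour), the 1-form leaves V-FED ∕ V-ONE ∕ …, any
identification of the transporters with Bałaban's `R(U(Γ))` of [B9] (3.8)–(3.15) (transporters are DATA; no B0, trigger c5), the END (owner).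

HONEST FRAMING (T4-DAG p. 1).  Model level; [folklore] telescoping + Cauchy–Schwarz + block bijection; nothing printed is a hypothesis (the
two `[cite:]` tags are SHAPE locators inherited from the scalar leaf); no `def … : Prop` fact; no `sorry`; axioms standard.  NE2 NOT proved;
spine PROVED 0∕9 unchanged; rung (B)+1 finite T⁴ — NOT infinite volume, NOT a mass gap, NOT Clay.  HONEST DEPENDENCY (cell, verbatim):
continuum YM on T⁴ ⇐ BetaPertH ∧ nine spine estimates (0/9 proved); BetaPertH ⇐ (D1) ∧ (D4) ∧ CAP+tail; G-an2-4 gates asym, D1 and NE2/3/4.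
-/

noncomputable section

namespace Summit.QuantumFields.BalabanUV.T4Continuum.VariationalColourFederbush

open Finset
open Literature.MathematicalPhysics.QuantumFieldTheory.Balaban1983to89
open Literature.MathematicalPhysics.QuantumFieldTheory.Balaban1983to89.B5Prop11Plancherel (Tor fine unitVec)
open Literature.MathematicalPhysics.QuantumFieldTheory.Balaban1983to89.B5Block118 (tstep tstep_zero tstep_succ bpt bpt_add_tstep)
open Summit.QuantumFields.BalabanUV.T4Continuum.VariationalCovariantFederbush (sum_sq_add_le invLd_mul_sqrt sum_fin_sq_add_le)

variable {d : ℕ} {E : Type*} [NormedAddCommGroup E] [NormedSpace ℂ E]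

/-! ## §1 Carriers: covariant difference, transported block average, straight transporter, mismatch — vector values -/

section Defs

variable (N : Fin d → ℕ) [∀ μ, NeZero (N μ)]

/-- the covariant forward difference of an `E`-valued field, `(D_R f)(y,μ) = R(y,μ)(f(y + e_μ)) − f(y)`, the transporter a continuous
linear map. [cite: Balaban1985BackgroundPropagators, (3.3) p.390 (shape)] [folklore] -/
def cDv (R : Tor N → Fin d → (E →L[ℂ] E)) (f : Tor N → E) (y : Tor N) (μ : Fin d) : E := R y μ (f (y + unitVec N μ)) - f y

/-- the covariant Dirichlet sum in direction `μ`: `Σ_y ‖(D_R f)(y,μ)‖²`. [folklore] -/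
def dirUv (R : Tor N → Fin d → (E →L[ℂ] E)) (f : Tor N → E) (μ : Fin d) : ℝ := ∑ y, ‖cDv N R f y μ‖ ^ 2

/-- the Dirichlet sum is nonnegative. [folklore] -/
theorem dirUv_nonneg (R : Tor N → Fin d → (E →L[ℂ] E)) (f : Tor N → E) (μ : Fin d) : 0 ≤ dirUv N R f μ :=
  sum_nonneg fun _ _ => by positivity

end Defs

section FineDefs

variable (L : ℕ) [NeZero L] (N : Fin d → ℕ) [∀ μ, NeZero (N μ)]

/-- the TRANSPORTED block average of an `E`-valued fine field, `(Q_{T′} f′)(y) = (L^d)⁻¹ • Σ_j T′(bpt y j)(f′(bpt y j))`.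
[cite: Balaban1985BackgroundPropagators, (3.19) p.393 (shape; site transports as data)] [folklore] -/
def Qcv (T' : Tor (fine L N) → (E →L[ℂ] E)) (f' : Tor (fine L N) → E) (y : Tor N) : E :=
  ((L : ℂ) ^ d)⁻¹ • ∑ j : Fin d → Fin L, T' (bpt L N y j) (f' (bpt L N y j))

/-- the straight path transporter of `t` fine bonds from `x′` in direction `μ`, a product in the ring `E →L[ℂ] E`:
`Π_0 = 1`, `Π_{t+1} = Π_t ∘ R′(x′ + t e_μ, μ)`. [folklore] -/
def piTv (R' : Tor (fine L N) → Fin d → (E →L[ℂ] E)) (x : Tor (fine L N)) (μ : Fin d) : ℕ → (E →L[ℂ] E)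
  | 0 => 1
  | t + 1 => piTv R' x μ t * R' (x + tstep (fine L N) μ t) μ

/-- the ONE-BLOCK TRANSPORT MISMATCH seen from the base point `j`, an element of `E →L[ℂ] E`:
`Mis(y,μ,j) = R̄(y,μ) ∘ T′(bpt (y+e_μ) j) − T′(bpt y j) ∘ Π_L(bpt y j, μ)`. [folklore] -/
def misv (Rc : Tor N → Fin d → (E →L[ℂ] E)) (R' : Tor (fine L N) → Fin d → (E →L[ℂ] E))
    (T' : Tor (fine L N) → (E →L[ℂ] E)) (y : Tor N) (μ : Fin d) (j : Fin d → Fin L) : E →L[ℂ] E :=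
  Rc y μ * T' (bpt L N (y + unitVec N μ) j) - T' (bpt L N y j) * piTv L N R' (bpt L N y j) μ L

end FineDefs

/-! ## §2 Covariant telescoping along a straight fine path -/

section Telescope

variable (L : ℕ) [NeZero L] (N : Fin d → ℕ) [∀ μ, NeZero (N μ)]

omit [NeZero L] [∀ μ, NeZero (N μ)] in
/-- `Π_t(f′(x′ + t e_μ)) − f′(x′) = Σ_{s<t} Π_s((D_{R′}f′)(x′ + s e_μ, μ))` (linearity of the transporters; no commutativity). [folklore] -/
theorem piTv_telescope (R' : Tor (fine L N) → Fin d → (E →L[ℂ] E)) (f' : Tor (fine L N) → E) (x : Tor (fine L N)) (μ : Fin d)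
    (t : ℕ) :
    piTv L N R' x μ t (f' (x + tstep (fine L N) μ t)) - f' x
      = ∑ s ∈ range t, piTv L N R' x μ s (cDv (fine L N) R' f' (x + tstep (fine L N) μ s) μ) := by
  induction t with
  | zero => simp [piTv, tstep_zero]
  | succ t ih =>
    rw [sum_range_succ, ← ih]
    simp only [piTv, cDv, mul_apply_eq_comp, map_sub, tstep_succ, ← add_assoc]
    abel

omit [NeZero L] [∀ μ, NeZero (N μ)] in
/-- transporters of operator norm `≤ 1` give straight transporters of operator norm `≤ 1`. [folklore] -/
theorem norm_piTv_le_one {R' : Tor (fine L N) → Fin d → (E →L[ℂ] E)} (hR' : ∀ x μ, ‖R' x μ‖ ≤ 1) (x : Tor (fine L N)) (μ : Fin d)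
    (t : ℕ) : ‖piTv L N R' x μ t‖ ≤ 1 := by
  induction t with
  | zero => exact ContinuousLinearMap.norm_id_le
  | succ t ih =>
    simp only [piTv]
    calc ‖piTv L N R' x μ t * R' (x + tstep (fine L N) μ t) μ‖ ≤ ‖piTv L N R' x μ t‖ * ‖R' (x + tstep (fine L N) μ t) μ‖ :=
          norm_mul_le _ _
      _ ≤ 1 * 1 := mul_le_mul ih (hR' _ _) (norm_nonneg _) zero_le_one
      _ = 1 := one_mul 1

end Telescope

/-! ## §3 The covariant difference of a transported average: exact decomposition and pointwise bound -/

section Pointwise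

variable (L : ℕ) [NeZero L] (N : Fin d → ℕ) [∀ μ, NeZero (N μ)]
variable (Rc : Tor N → Fin d → (E →L[ℂ] E)) (R' : Tor (fine L N) → Fin d → (E →L[ℂ] E)) (T' : Tor (fine L N) → (E →L[ℂ] E))

omit [NeZero L] [∀ μ, NeZero (N μ)] in
/-- **EXACT DECOMPOSITION**:
`(D_{R̄} Q_{T′}f′)(y,μ) = (L^d)⁻¹ • Σ_j [ T′(bpt y j)(Σ_{s<L} Π_s((D_{R′}f′)(bpt y j + s e_μ, μ))) + Mis(y,μ,j)(f′(bpt (y+e_μ) j)) ]`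
(uses `B(y) + L e_μ = B(y + e_μ)`, tree `B5Block118.bpt_add_tstep`; no commutativity). [folklore] -/
theorem cDv_Qcv_eq (f' : Tor (fine L N) → E) (y : Tor N) (μ : Fin d) :
    cDv N Rc (Qcv L N T' f') y μ
      = ((L : ℂ) ^ d)⁻¹ • ∑ j : Fin d → Fin L,
          (T' (bpt L N y j) (∑ s ∈ range L, piTv L N R' (bpt L N y j) μ s (cDv (fine L N) R' f' (bpt L N y j + tstep (fine L N) μ s) μ))
            + misv L N Rc R' T' y μ j (f' (bpt L N (y + unitVec N μ) j))) := by
  have key : ∀ j : Fin d → Fin L,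
      T' (bpt L N y j) (∑ s ∈ range L, piTv L N R' (bpt L N y j) μ s (cDv (fine L N) R' f' (bpt L N y j + tstep (fine L N) μ s) μ))
        + misv L N Rc R' T' y μ j (f' (bpt L N (y + unitVec N μ) j))
      = Rc y μ (T' (bpt L N (y + unitVec N μ) j) (f' (bpt L N (y + unitVec N μ) j))) - T' (bpt L N y j) (f' (bpt L N y j)) := by
    intro j
    rw [← piTv_telescope, bpt_add_tstep]
    simp only [misv, sub_apply, mul_apply_eq_comp, map_sub]
    abel
  simp_rw [key]
  rw [sum_sub_distrib, smul_sub]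
  unfold cDv Qcv
  rw [map_smul, map_sum]

omit [NeZero L] [∀ μ, NeZero (N μ)] in
/-- **POINTWISE BOUND** (contractions `‖R′‖, ‖T′‖ ≤ 1`, mismatch `‖Mis‖ ≤ m`, all operator norms):
`‖(D_{R̄} Q_{T′}f′)(y,μ)‖ ≤ (L^d)⁻¹·Σ_j [ Σ_{s<L} ‖(D_{R′}f′)(bpt y j + s e_μ, μ)‖ + m·‖f′(bpt (y+e_μ) j)‖ ]`. [folklore] -/
theorem norm_cDv_Qcv_le (hR' : ∀ x μ, ‖R' x μ‖ ≤ 1) (hT' : ∀ x, ‖T' x‖ ≤ 1) {m : ℝ}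
    (hmis : ∀ y μ j, ‖misv L N Rc R' T' y μ j‖ ≤ m) (f' : Tor (fine L N) → E) (y : Tor N) (μ : Fin d) :
    ‖cDv N Rc (Qcv L N T' f') y μ‖
      ≤ ((L : ℝ) ^ d)⁻¹ * ∑ j : Fin d → Fin L,
          (∑ s ∈ range L, ‖cDv (fine L N) R' f' (bpt L N y j + tstep (fine L N) μ s) μ‖ + m * ‖f' (bpt L N (y + unitVec N μ) j)‖) := by
  rw [cDv_Qcv_eq, norm_smul, VariationalCovariantFederbush.norm_invLd]
  refine mul_le_mul_of_nonneg_left ((norm_sum_le _ _).trans (sum_le_sum fun j _ => ?_)) (by positivity)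
  refine (norm_add_le _ _).trans (add_le_add ?_ ?_)
  · calc ‖T' (bpt L N y j) (∑ s ∈ range L, piTv L N R' (bpt L N y j) μ s (cDv (fine L N) R' f' (bpt L N y j + tstep (fine L N) μ s) μ))‖
        ≤ ‖T' (bpt L N y j)‖ * ‖∑ s ∈ range L, piTv L N R' (bpt L N y j) μ s (cDv (fine L N) R' f' (bpt L N y j + tstep (fine L N) μ s) μ)‖ :=
          ContinuousLinearMap.le_opNorm _ _
      _ ≤ 1 * ∑ s ∈ range L, ‖cDv (fine L N) R' f' (bpt L N y j + tstep (fine L N) μ s) μ‖ := by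
          refine mul_le_mul (hT' _) ((norm_sum_le _ _).trans (sum_le_sum fun s _ => ?_)) (norm_nonneg _) zero_le_one
          calc ‖piTv L N R' (bpt L N y j) μ s (cDv (fine L N) R' f' (bpt L N y j + tstep (fine L N) μ s) μ)‖
              ≤ ‖piTv L N R' (bpt L N y j) μ s‖ * ‖cDv (fine L N) R' f' (bpt L N y j + tstep (fine L N) μ s) μ‖ :=
                ContinuousLinearMap.le_opNorm _ _
            _ ≤ 1 * ‖cDv (fine L N) R' f' (bpt L N y j + tstep (fine L N) μ s) μ‖ :=
                mul_le_mul_of_nonneg_right (norm_piTv_le_one L N hR' _ _ _) (norm_nonneg _)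
            _ = _ := one_mul _
      _ = _ := one_mul _
  · calc ‖misv L N Rc R' T' y μ j (f' (bpt L N (y + unitVec N μ) j))‖
        ≤ ‖misv L N Rc R' T' y μ j‖ * ‖f' (bpt L N (y + unitVec N μ) j)‖ := ContinuousLinearMap.le_opNorm _ _
      _ ≤ m * ‖f' (bpt L N (y + unitVec N μ) j)‖ := mul_le_mul_of_nonneg_right (hmis y μ j) (norm_nonneg _)

end Pointwise

/-! ## §4 Summing the squares (the ℝ-side of the scalar leaf BY NAME) -/

section Sums

variable (L : ℕ) [NeZero L] (N : Fin d → ℕ) [∀ μ, NeZero (N μ)]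
variable (Rc : Tor N → Fin d → (E →L[ℂ] E)) (R' : Tor (fine L N) → Fin d → (E →L[ℂ] E)) (T' : Tor (fine L N) → (E →L[ℂ] E))

/-- the main-term count `Σ_y (Σ_j Σ_{s<L} ‖D′f′(bpt y j + s e_μ)‖)² ≤ L^d·L·L·X_μ` — the scalar leaf's count BY NAME, read on the real
fine functional `x′ ↦ ‖(D_{R′}f′)(x′,μ)‖` (as the field, with zero phases: `‖cD 0 g‖ = ‖g‖`). [folklore] -/
theorem sum_sq_main_le (f' : Tor (fine L N) → E) (μ : Fin d) :
    ∑ y : Tor N, (∑ j : Fin d → Fin L, ∑ s ∈ range L, ‖cDv (fine L N) R' f' (bpt L N y j + tstep (fine L N) μ s) μ‖) ^ 2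
      ≤ (L : ℝ) ^ d * L * (L * dirUv (fine L N) R' f' μ) := by
  have h := VariationalCovariantFederbush.sum_sq_main_le L N (fun _ _ => (0 : ℂ))
    (fun x => ((‖cDv (fine L N) R' f' x μ‖ : ℝ) : ℂ)) μ
  have e : ∀ x, ‖VariationalCovariantFederbush.cD (fine L N) (fun _ _ => (0 : ℂ)) (fun x => ((‖cDv (fine L N) R' f' x μ‖ : ℝ) : ℂ)) x μ‖
      = ‖cDv (fine L N) R' f' x μ‖ := fun x => by
    simp [VariationalCovariantFederbush.cD, Complex.norm_real]
  simpa only [e, VariationalCovariantFederbush.dirU, dirUv] using h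

omit [NormedSpace ℂ E] in
/-- the defect-term count `Σ_y (Σ_j ‖f′(bpt (y+e_μ) j)‖)² ≤ L^d·Y` — the scalar leaf's count BY NAME on `x′ ↦ ‖f′ x′‖`. [folklore] -/
theorem sum_sq_defect_le (f' : Tor (fine L N) → E) (μ : Fin d) :
    ∑ y : Tor N, (∑ j : Fin d → Fin L, ‖f' (bpt L N (y + unitVec N μ) j)‖) ^ 2 ≤ (L : ℝ) ^ d * ∑ x, ‖f' x‖ ^ 2 := by
  simpa only [Complex.norm_real, Real.norm_eq_abs, abs_norm] using
    VariationalCovariantFederbush.sum_sq_defect_le L N (fun x => ((‖f' x‖ : ℝ) : ℂ)) μ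

/-- **LEAF V-COL-FED (lattice units, raw form)**: under contractive transporters and mismatch `≤ m`,
`Σ_y ‖(D_{R̄} Q_{T′}f′)(y,μ)‖² ≤ (L^d)⁻² · ( √(L^d·L·(L·X_μ)) + m·√(L^d·Y) )²`. [folklore] -/
theorem dirUv_Qcv_le_raw (hR' : ∀ x μ, ‖R' x μ‖ ≤ 1) (hT' : ∀ x, ‖T' x‖ ≤ 1) {m : ℝ} (hm : 0 ≤ m)
    (hmis : ∀ y μ j, ‖misv L N Rc R' T' y μ j‖ ≤ m) (f' : Tor (fine L N) → E) (μ : Fin d) :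
    dirUv N Rc (Qcv L N T' f') μ
      ≤ (((L : ℝ) ^ d)⁻¹) ^ 2 *
          (Real.sqrt ((L : ℝ) ^ d * L * (L * dirUv (fine L N) R' f' μ)) + m * Real.sqrt ((L : ℝ) ^ d * ∑ x, ‖f' x‖ ^ 2)) ^ 2 := by
  let A : Tor N → ℝ := fun y => ∑ j : Fin d → Fin L, ∑ s ∈ range L, ‖cDv (fine L N) R' f' (bpt L N y j + tstep (fine L N) μ s) μ‖
  let B : Tor N → ℝ := fun y => ∑ j : Fin d → Fin L, ‖f' (bpt L N (y + unitVec N μ) j)‖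
  have hpt : ∀ y, ‖cDv N Rc (Qcv L N T' f') y μ‖ ≤ ((L : ℝ) ^ d)⁻¹ * (A y + m * B y) := by
    intro y
    have h := norm_cDv_Qcv_le L N Rc R' T' hR' hT' hmis f' y μ
    rw [sum_add_distrib, ← mul_sum] at h
    exact h
  have hsq : ∀ y, ‖cDv N Rc (Qcv L N T' f') y μ‖ ^ 2 ≤ (((L : ℝ) ^ d)⁻¹) ^ 2 * (A y + m * B y) ^ 2 := by
    intro y
    rw [← mul_pow]
    exact pow_le_pow_left₀ (norm_nonneg _) (hpt y) 2
  have h1 : Real.sqrt (∑ y, A y ^ 2) ≤ Real.sqrt ((L : ℝ) ^ d * L * (L * dirUv (fine L N) R' f' μ)) :=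
    Real.sqrt_le_sqrt (sum_sq_main_le L N R' f' μ)
  have h2 : Real.sqrt (∑ y, B y ^ 2) ≤ Real.sqrt ((L : ℝ) ^ d * ∑ x, ‖f' x‖ ^ 2) :=
    Real.sqrt_le_sqrt (sum_sq_defect_le L N f' μ)
  have hl : 0 ≤ Real.sqrt (∑ y, A y ^ 2) + m * Real.sqrt (∑ y, B y ^ 2) := by positivity
  unfold dirUv
  calc ∑ y, ‖cDv N Rc (Qcv L N T' f') y μ‖ ^ 2
      ≤ ∑ y, (((L : ℝ) ^ d)⁻¹) ^ 2 * (A y + m * B y) ^ 2 := sum_le_sum fun y _ => hsq y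
    _ = (((L : ℝ) ^ d)⁻¹) ^ 2 * ∑ y, (A y + m * B y) ^ 2 := by rw [mul_sum]
    _ ≤ (((L : ℝ) ^ d)⁻¹) ^ 2 * (Real.sqrt (∑ y, A y ^ 2) + m * Real.sqrt (∑ y, B y ^ 2)) ^ 2 :=
        mul_le_mul_of_nonneg_left (sum_sq_add_le _ A B hm) (by positivity)
    _ ≤ (((L : ℝ) ^ d)⁻¹) ^ 2 *
          (Real.sqrt ((L : ℝ) ^ d * L * (L * dirUv (fine L N) R' f' μ)) + m * Real.sqrt ((L : ℝ) ^ d * ∑ x, ‖f' x‖ ^ 2)) ^ 2 :=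
        mul_le_mul_of_nonneg_left (pow_le_pow_left₀ hl (add_le_add h1 (mul_le_mul_of_nonneg_left h2 hm)) 2) (by positivity)

/-- **LEAF V-COL-FED (lattice units, clean form): THE COVARIANT FEDERBUSH INEQUALITY, ADDITIVE FORM, VECTOR VALUES** — one block step of
side `L`, every torus, every fine field `f′ : Tor (fine L N) → E`, every direction `μ`, transporters in `E →L[ℂ] E` of operator norm `≤ 1`,
mismatch `‖Mis‖_op ≤ m`:  `Σ_y ‖(D_{R̄} Q_{T′}f′)(y,μ)‖² ≤ ( √(L²·X_μ∕L^d) + m·√(Y∕L^d) )²`.  The main term has constant EXACTLY 1; the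
background enters only through `m`. [folklore] -/
theorem dirUv_Qcv_le (hR' : ∀ x μ, ‖R' x μ‖ ≤ 1) (hT' : ∀ x, ‖T' x‖ ≤ 1) {m : ℝ} (hm : 0 ≤ m)
    (hmis : ∀ y μ j, ‖misv L N Rc R' T' y μ j‖ ≤ m) (f' : Tor (fine L N) → E) (μ : Fin d) :
    dirUv N Rc (Qcv L N T' f') μ
      ≤ (Real.sqrt ((L : ℝ) ^ 2 * dirUv (fine L N) R' f' μ / (L : ℝ) ^ d) + m * Real.sqrt ((∑ x, ‖f' x‖ ^ 2) / (L : ℝ) ^ d)) ^ 2 := by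
  have h := dirUv_Qcv_le_raw L N Rc R' T' hR' hT' hm hmis f' μ
  obtain ⟨e1, -⟩ := invLd_mul_sqrt L (d := d) (∑ x, ‖f' x‖ ^ 2)
  obtain ⟨-, e3⟩ := invLd_mul_sqrt L (d := d) (dirUv (fine L N) R' f' μ)
  rw [← e1, ← e3]
  calc dirUv N Rc (Qcv L N T' f') μ ≤ _ := h
    _ = (((L : ℝ) ^ d)⁻¹ * Real.sqrt ((L : ℝ) ^ d * L * (L * dirUv (fine L N) R' f' μ))
          + m * (((L : ℝ) ^ d)⁻¹ * Real.sqrt ((L : ℝ) ^ d * ∑ x, ‖f' x‖ ^ 2))) ^ 2 := by ring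

/-- **LEAF V-COL-FED SUMMED OVER DIRECTIONS**:
`Σ_μ Σ_y ‖(D_{R̄} Q_{T′}f′)(y,μ)‖² ≤ ( √(L²·Σ_μ X_μ∕L^d) + √d·m·√(Y∕L^d) )²` — in physical units at level `n = L^k` (prefactor `n^{2−d}`):
`Sc(Q_{T′}f′) ≤ (√Sf(f′) + √d·(n m)·‖f′‖_{L²})²`, the `federbush` defect of the canonical pair, SAME constants as the scalar leaf. [folklore] -/
theorem sum_dirUv_Qcv_le (hR' : ∀ x μ, ‖R' x μ‖ ≤ 1) (hT' : ∀ x, ‖T' x‖ ≤ 1) {m : ℝ} (hm : 0 ≤ m)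
    (hmis : ∀ y μ j, ‖misv L N Rc R' T' y μ j‖ ≤ m) (f' : Tor (fine L N) → E) :
    ∑ μ, dirUv N Rc (Qcv L N T' f') μ
      ≤ (Real.sqrt ((L : ℝ) ^ 2 * (∑ μ, dirUv (fine L N) R' f' μ) / (L : ℝ) ^ d)
          + Real.sqrt d * (m * Real.sqrt ((∑ x, ‖f' x‖ ^ 2) / (L : ℝ) ^ d))) ^ 2 := by
  have hL : (0 : ℝ) < (L : ℝ) ^ d := by have := NeZero.ne L; positivity
  set a : Fin d → ℝ := fun μ => Real.sqrt ((L : ℝ) ^ 2 * dirUv (fine L N) R' f' μ / (L : ℝ) ^ d) with ha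
  set b : ℝ := m * Real.sqrt ((∑ x, ‖f' x‖ ^ 2) / (L : ℝ) ^ d) with hb
  have hb0 : 0 ≤ b := by positivity
  have hsum : ∑ μ, a μ ^ 2 = (L : ℝ) ^ 2 * (∑ μ, dirUv (fine L N) R' f' μ) / (L : ℝ) ^ d := by
    simp only [ha]
    rw [mul_sum, sum_div]
    refine sum_congr rfl fun μ _ => Real.sq_sqrt ?_
    exact div_nonneg (mul_nonneg (sq_nonneg _) (dirUv_nonneg _ _ _ _)) hL.le
  calc ∑ μ, dirUv N Rc (Qcv L N T' f') μ ≤ ∑ μ, (a μ + b) ^ 2 :=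
        sum_le_sum fun μ _ => dirUv_Qcv_le L N Rc R' T' hR' hT' hm hmis f' μ
    _ ≤ (Real.sqrt (∑ μ, a μ ^ 2) + Real.sqrt d * b) ^ 2 := sum_fin_sq_add_le a hb0
    _ = _ := by rw [hsum]

end Sums

/-! ## §5 Readings: the scalar leaf is the instance `E = ℂ`; unitary transporters; the matrix (colour) reading -/

section ScalarReading

variable (L : ℕ) [NeZero L] (N : Fin d → ℕ) [∀ μ, NeZero (N μ)]

/-- a U(1) phase field read as a field of continuous linear maps `ℂ →L[ℂ] ℂ` (multiplication operators). [folklore] -/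
def phase {X : Type*} (R : X → ℂ) : X → (ℂ →L[ℂ] ℂ) := fun x => R x • (1 : ℂ →L[ℂ] ℂ)

/-- `phase R x` acts by multiplication. [folklore] -/
@[simp] theorem phase_apply {X : Type*} (R : X → ℂ) (x : X) (v : ℂ) : phase R x v = R x * v := by
  simp [phase, smul_eq_mul]

/-- `‖phase R x‖ = ‖R x‖`. [folklore] -/
@[simp] theorem norm_phase {X : Type*} (R : X → ℂ) (x : X) : ‖phase R x‖ = ‖R x‖ := by
  rw [phase, norm_smul, norm_one, mul_one]

omit [∀ μ, NeZero (N μ)] in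
/-- CONSISTENCY WITH THE SCALAR LEAF: the vector covariant difference at `E = ℂ` IS `VariationalCovariantFederbush.cD`. [folklore] -/
theorem cDv_phase (R : Tor N → Fin d → ℂ) (f : Tor N → ℂ) (y : Tor N) (μ : Fin d) :
    cDv N (fun y => phase (R y)) f y μ = VariationalCovariantFederbush.cD N R f y μ := by
  simp [cDv, VariationalCovariantFederbush.cD]

/-- … hence the Dirichlet sums agree. [folklore] -/
theorem dirUv_phase (R : Tor N → Fin d → ℂ) (f : Tor N → ℂ) (μ : Fin d) :
    dirUv N (fun y => phase (R y)) f μ = VariationalCovariantFederbush.dirU N R f μ := by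
  simp [dirUv, VariationalCovariantFederbush.dirU, cDv_phase]

omit [NeZero L] [∀ μ, NeZero (N μ)] in
/-- the transported average at `E = ℂ` IS `VariationalCovariantFederbush.Qc`. [folklore] -/
theorem Qcv_phase (T' : Tor (fine L N) → ℂ) (f' : Tor (fine L N) → ℂ) (y : Tor N) :
    Qcv L N (phase T') f' y = VariationalCovariantFederbush.Qc L N T' f' y := by
  simp [Qcv, VariationalCovariantFederbush.Qc, smul_eq_mul]

omit [NeZero L] [∀ μ, NeZero (N μ)] in
/-- the straight transporter at `E = ℂ` IS (multiplication by) `VariationalCovariantFederbush.piT`. [folklore] -/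
theorem piTv_phase (R' : Tor (fine L N) → Fin d → ℂ) (x : Tor (fine L N)) (μ : Fin d) (t : ℕ) :
    piTv L N (fun x => phase (R' x)) x μ t = VariationalCovariantFederbush.piT L N R' x μ t • (1 : ℂ →L[ℂ] ℂ) := by
  induction t with
  | zero => simp [piTv, VariationalCovariantFederbush.piT]
  | succ t ih =>
    simp only [piTv, VariationalCovariantFederbush.piT, ih, phase]
    rw [smul_mul_smul_comm, mul_one]

omit [NeZero L] [∀ μ, NeZero (N μ)] in
/-- the mismatch at `E = ℂ` IS (multiplication by) `VariationalCovariantFederbush.mis`; in particular the norms agree. [folklore] -/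
theorem norm_misv_phase (Rc : Tor N → Fin d → ℂ) (R' : Tor (fine L N) → Fin d → ℂ) (T' : Tor (fine L N) → ℂ) (y : Tor N) (μ : Fin d)
    (j : Fin d → Fin L) :
    ‖misv L N (fun y => phase (Rc y)) (fun x => phase (R' x)) (phase T') y μ j‖ = ‖VariationalCovariantFederbush.mis L N Rc R' T' y μ j‖ := by
  have e : misv L N (fun y => phase (Rc y)) (fun x => phase (R' x)) (phase T') y μ j
      = VariationalCovariantFederbush.mis L N Rc R' T' y μ j • (1 : ℂ →L[ℂ] ℂ) := by
    simp only [misv, piTv_phase, phase, VariationalCovariantFederbush.mis]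
    rw [smul_mul_smul_comm, smul_mul_smul_comm, mul_one, ← sub_smul]
  rw [e, norm_smul, norm_one, mul_one]

end ScalarReading

section Unitary

variable {H : Type*} [NormedAddCommGroup H] [InnerProductSpace ℂ H] [CompleteSpace H]
variable (L : ℕ) [NeZero L] (N : Fin d → ℕ) [∀ μ, NeZero (N μ)]

/-- a unitary element of `H →L[ℂ] H` has operator norm `≤ 1` (`= 1` unless `H` is trivial). [folklore] -/
theorem norm_le_one_of_mem_unitary {U : H →L[ℂ] H} (hU : U ∈ unitary (H →L[ℂ] H)) : ‖U‖ ≤ 1 := by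
  have h : ‖U * 1‖ = ‖(1 : H →L[ℂ] H)‖ := CStarRing.norm_mem_unitary_mul 1 hU
  rw [mul_one] at h
  exact h ▸ ContinuousLinearMap.norm_id_le

/-- **V-COL-FED FOR UNITARY DATA**: if the coarse, fine and site transporters are unitary operators on a Hilbert space `H`, the only
binder left is the mismatch bound `m`. [folklore] -/
theorem dirUv_Qcv_le_of_unitary {Rc : Tor N → Fin d → (H →L[ℂ] H)} {R' : Tor (fine L N) → Fin d → (H →L[ℂ] H)}
    {T' : Tor (fine L N) → (H →L[ℂ] H)} (hR' : ∀ x μ, R' x μ ∈ unitary (H →L[ℂ] H)) (hT' : ∀ x, T' x ∈ unitary (H →L[ℂ] H))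
    {m : ℝ} (hm : 0 ≤ m) (hmis : ∀ y μ j, ‖misv L N Rc R' T' y μ j‖ ≤ m) (f' : Tor (fine L N) → H) (μ : Fin d) :
    dirUv N Rc (Qcv L N T' f') μ
      ≤ (Real.sqrt ((L : ℝ) ^ 2 * dirUv (fine L N) R' f' μ / (L : ℝ) ^ d) + m * Real.sqrt ((∑ x, ‖f' x‖ ^ 2) / (L : ℝ) ^ d)) ^ 2 :=
  dirUv_Qcv_le L N Rc R' T' (fun x μ => norm_le_one_of_mem_unitary (hR' x μ)) (fun x => norm_le_one_of_mem_unitary (hT' x)) hm hmis f' μ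

end Unitary

section MatrixReading

open scoped Matrix

variable {o : Type*} [Fintype o] [DecidableEq o]
variable (L : ℕ) [NeZero L] (N : Fin d → ℕ) [∀ μ, NeZero (N μ)]

/-- Mathlib's ⋆-algebra equivalence `Matrix.toEuclideanCLM` sends unitary matrices to unitary operators on `EuclideanSpace ℂ o`. [folklore] -/
theorem toEuclideanCLM_mem_unitary {U : Matrix o o ℂ} (hU : U ∈ Matrix.unitaryGroup o ℂ) :
    Matrix.toEuclideanCLM (n := o) (𝕜 := ℂ) U ∈ unitary (EuclideanSpace ℂ o →L[ℂ] EuclideanSpace ℂ o) := by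
  rw [Unitary.mem_iff] at hU ⊢
  refine ⟨?_, ?_⟩
  · have h := congrArg (Matrix.toEuclideanCLM (n := o) (𝕜 := ℂ)) hU.1
    rwa [map_mul, map_star, map_one] at h
  · have h := congrArg (Matrix.toEuclideanCLM (n := o) (𝕜 := ℂ)) hU.2
    rwa [map_mul, map_star, map_one] at h

/-- **V-COL-FED, THE MATRIX (COLOUR) READING**: unitary colour matrices `Ū(y,μ), U′(x′,μ), V′(x′) ∈ U(o)` transporting colour vectors
`f′(x′) ∈ ℂ^o = EuclideanSpace ℂ o` (through `Matrix.toEuclideanCLM`, i.e. `f ↦ U *ᵥ f`), mismatch `≤ m` in the L²-operator norm: the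
additive covariant Federbush inequality with NO binder but `m`.  (Matrix-valued fields under LEFT multiplication with the Frobenius norm are
`o` copies of this instance, column by column.) [folklore] -/
theorem dirUv_Qcv_le_matrix {Uc : Tor N → Fin d → Matrix o o ℂ} {U' : Tor (fine L N) → Fin d → Matrix o o ℂ}
    {V' : Tor (fine L N) → Matrix o o ℂ} (hU' : ∀ x μ, U' x μ ∈ Matrix.unitaryGroup o ℂ) (hV' : ∀ x, V' x ∈ Matrix.unitaryGroup o ℂ)
    {m : ℝ} (hm : 0 ≤ m)
    (hmis : ∀ y μ j, ‖misv L N (fun y μ => Matrix.toEuclideanCLM (n := o) (𝕜 := ℂ) (Uc y μ))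
      (fun x μ => Matrix.toEuclideanCLM (n := o) (𝕜 := ℂ) (U' x μ)) (fun x => Matrix.toEuclideanCLM (n := o) (𝕜 := ℂ) (V' x)) y μ j‖ ≤ m)
    (f' : Tor (fine L N) → EuclideanSpace ℂ o) (μ : Fin d) :
    dirUv N (fun y μ => Matrix.toEuclideanCLM (n := o) (𝕜 := ℂ) (Uc y μ))
        (Qcv L N (fun x => Matrix.toEuclideanCLM (n := o) (𝕜 := ℂ) (V' x)) f') μ
      ≤ (Real.sqrt ((L : ℝ) ^ 2 * dirUv (fine L N) (fun x μ => Matrix.toEuclideanCLM (n := o) (𝕜 := ℂ) (U' x μ)) f' μ / (L : ℝ) ^ d)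
          + m * Real.sqrt ((∑ x, ‖f' x‖ ^ 2) / (L : ℝ) ^ d)) ^ 2 :=
  dirUv_Qcv_le_of_unitary L N (fun x μ => toEuclideanCLM_mem_unitary (hU' x μ)) (fun x => toEuclideanCLM_mem_unitary (hV' x)) hm hmis f' μ

end MatrixReading

end Summit.QuantumFields.BalabanUV.T4Continuum.VariationalColourFederbush

end
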